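import Literature.AlgebraicGeometry.HodgeTheory.BettiPoincarePolynomial
import Literature.AlgebraicGeometry.HodgeTheory.BettiHodgePolynomial
import HarnessLib

/-!
# `Π_{t,t}(X) = P(t; X)`: Hirzebruch's (18*) `b_r = Σ_{p+q=r} h^{p,q}` as the identity «Hodge polynomial on the diagonal = Poincaré polynomial» in `ℤ[t]`, and the K3 HODGE DIAMOND as
# generating functions: `Π(S) = 1 + y² + 20·yz + z² + y²z²`, `χ_y(S) = 2 − 20y + 2y²`, `P(t; S) = 1 + 22t² + t⁴` (given the two `Surfaces/` K3 facts, as in g25-#2)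

Family `hodge`, lane `lit-hodgefound` (Track 2 foundations library; Layer A1), layer `Literature/AlgebraicGeometry/HodgeTheory`.  THEOREMS ONLY (no definition,
no named fact, no instance; D-0026 net debt `0`).  Sequel of the seat's g25-#8 (`χ_y ∈ ℤ[y]`), g25-#9 (`P ∈ ℤ[t]`) and g25-#10 (`Π_{y,z} ∈ ℤ[y][z]`, whose `Π_{y,−1} = χ_y` is used for the K3 `χ_y`).  §1: evaluating the outer variable of `Π(X) = Σ_{p,q ≤ n} C(C(h^{p,q}) y^p) z^q` at the inner variable (`y = z = t`) gives
`Σ_{p,q} h^{p,q} t^{p+q}`, which is the Poincaré polynomial `Σ_k b_k t^k` by Hirzebruch's (18*) `b_r(V) = Σ_{p+q=r} h^{p,q}(V)` (the lane's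
`BettiUniverse.finrank_bettiCohomology_eq_sum_hodgeNumber_hodge`); the proof is the re-indexing `(k, p ≤ k) ↔ (p, q)` of the triangle onto the box, out-of-range terms vanishing.
§2: the K3 Hodge diamond `h^{0,0} = h^{2,2} = h^{2,0} = h^{0,2} = 1`, `h^{1,1} = 20`, all others `0`, read off the tree's `Surfaces/K3SurfaceHodgeGroupsPicardNumber` under its two named
facts `Huybrechts_K3_oddBetti_vanish` (`H¹ = H³ = 0`) and `K3_finrank_complexBetti_two` (`b₂ = 22`) taken as hypotheses exactly as in g25-#2, packaged as `Π`, `χ_y` and `P`.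

THE PRINTS.  F. Hirzebruch (1966) [Hirzebruch1966] §15.6 (18*) (held text p0134) «Therefore the `r`-th Betti number `b_r(V)` satisfies `b_r(V) = Σ_{p+q=r} h^{p,q}(V)`»; §15.10 (p0138)
«the Poincaré polynomial `P(t; V) = Σ b_r t^r`»; §15.11 (p0138) «the polynomial `Π_{y,z}(V) = Σ_{p,q} h^{p,q} y^p z^q`».  N. Yui (2013) [Yui2013] §1.4 Example 1 (b) (held text p0221):
the K3 surface, `h^{1,0} = 0`, `p_g = 1`, `h^{1,1} = 20`, `B₂ = 22`, `E = 24`.  D. Huybrechts (2016) [Huybrechts2016K3] Ch. 1 §2.4 (2.7), §3.3: the Hodge diamond of a K3 surface.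

THE OBJECTS (all the tree's and Mathlib's).  `hX : IsSmoothProjective n X`; `Π(X) ∈ Polynomial (Polynomial ℤ)`, `χ_y(X) ∈ Polynomial ℤ`, `P(X) ∈ Polynomial ℤ` displayed as in g25-#8/#9/#10;
`IsK3Surface S` (`Surfaces/K3Surface`), the facts `Huybrechts_K3_oddBetti_vanish`, `K3_finrank_complexBetti_two` as hypotheses.

WHAT IS PROVED.
* §1 **`BettiUniverse.hodgePoly_eval_X`** — `Π(X).eval t = P(t; X)` ((18*) as a polynomial identity).
* §2 `BettiUniverse.hodgeNumber_hodge_four_two_two_surface` (`h^{2,2} = 1` for every surface), `IsK3Surface.hodgeNumber_hodge_three_one_two` / `_three_two_one` (`h^{1,2} = h^{2,1} = 0`),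
  **`IsK3Surface.hodgePoly`** (`Π(S) = 1 + y² + 20yz + z² + y²z²`), **`IsK3Surface.chiYPoly`** (`χ_y(S) = 2 − 20y + 2y²`, via g25-#10's `Π_{y,−1} = χ_y`), **`IsK3Surface.poincarePoly`** (`P(S) = 1 + 22t² + t⁴`).

DEVIATIONS / SCOPE.  The K3 values are conditional on the two named `Surfaces/` facts (not discharged here: they need the Dolbeault/GAGA link `H¹(S, 𝒪_S) = 0 ⟹ b₁ = 0` and
`b₂ = 22` from Noether's formula, absent from the tree); nothing is defined.

## References
* [Hirzebruch1966] F. Hirzebruch, *Topological Methods in Algebraic Geometry* (1966) — §15.6 (18*) (held text p0134); §15.10, §15.11 (p0138).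
* [Yui2013] N. Yui, *Modularity of Calabi–Yau varieties: 2011 and beyond* (2013) — §1.4 Example 1 (b) (held text p0221).
* [Huybrechts2016K3] D. Huybrechts, *Lectures on K3 Surfaces* (2016) — Ch. 1 §2.4 (2.7), §3.3.
* [HatcherAT2002] A. Hatcher, *Algebraic Topology* (2002) — §3.2 Exercise 15 (held text p0296); §3.3 Cor. 3.37.
* [VoisinHodgeI2002] C. Voisin, *Hodge Theory and Complex Algebraic Geometry I* (2002) — §6.1.3 Cor. 6.13, §6.3.2.
* [Arapura2012] D. Arapura, *Algebraic Geometry over the Complex Numbers* (2012) — §11.1 (PDF p. 174).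

## Provenance
Lane `lit-hodgefound` (Hodge path, Track 2), prover seat `lit-hodgefound-p29` (generation 25), self-proposed row g25-#11 (`Π_{t,t} = P`; K3 generating functions; sequel of g25-#8/#9/#10).
-/

noncomputable section

open scoped TensorProduct
open CategoryTheory MonoidalCategory Module Finset
open Polynomial (C)
open Literature.AlgebraicTopology.SingularHomology

namespace Literature.AlgebraicGeometry.HodgeTheory

open Literature.AlgebraicGeometry.Motives
open Literature.AlgebraicGeometry.Motives.HodgeStructure
open Literature.AlgebraicGeometry.Surfaces

variable {m n : ℕ} {X Y Z : SchemeOver ℂ}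

/-! ### §1 (18*): `Π_{t,t}(X) = P(t; X)` -/

/-- **`Π(X).eval t = P(t; X)`: Hirzebruch's (18*) `b_r = Σ_{p+q=r} h^{p,q}` as a polynomial identity** — evaluating the outer variable `z` of `Π(X) = Σ_{p,q ≤ n} h^{p,q} y^p z^q ∈ ℤ[y][z]`
at the inner variable gives `Σ_{p,q} h^{p,q} t^{p+q} = Σ_{k ≤ 2n} b_k t^k` (the triangle `p ≤ k ≤ 2n` re-indexed onto the box `p, q ≤ n`, the terms with `p > n` or `q > n` vanishing).
[cite: Hirzebruch1966, §15.6 (18*) (held text p0134) and §15.10–15.11 (p0138)] -/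
theorem BettiUniverse.hodgePoly_eval_X (hHD : exists_isReal_hodgeModel) (hX : IsSmoothProjective n X) :
    (∑ i ∈ range (n + 1), ∑ j ∈ range (n + 1),
        C (C (((BettiUniverse.hodge hHD hX (i + j)).hodgeNumber i j : ℕ) : ℤ) * Polynomial.X ^ i) * Polynomial.X ^ j : Polynomial (Polynomial ℤ)).eval Polynomial.X =
      ∑ k ∈ range (2 * n + 1), C (Module.finrank ℚ (bettiCohomology X k) : ℤ) * Polynomial.X ^ k := by
  rw [Polynomial.eval_finsetSum]
  simp_rw [Polynomial.eval_finsetSum, Polynomial.eval_mul, Polynomial.eval_C, Polynomial.eval_pow, Polynomial.eval_X]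
  have hP : ∑ k ∈ range (2 * n + 1), C (Module.finrank ℚ (bettiCohomology X k) : ℤ) * Polynomial.X ^ k =
      ∑ k ∈ range (2 * n + 1), ∑ p ∈ range (k + 1),
        C ((((BettiUniverse.hodge hHD hX (p + (k - p))).hodgeNumber p (k - p : ℕ)) : ℕ) : ℤ) * Polynomial.X ^ p * Polynomial.X ^ (k - p) := by
    refine Finset.sum_congr rfl fun k _ => ?_
    rw [BettiUniverse.finrank_bettiCohomology_eq_sum_hodgeNumber_hodge hHD hX k, Nat.cast_sum, map_sum, Finset.sum_mul]
    refine Finset.sum_congr rfl fun p hp => ?_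
    have hpk : p ≤ k := by have := Finset.mem_range.1 hp; omega
    rw [mul_assoc, ← pow_add, Nat.add_sub_cancel' hpk]
  have hswap : ∀ k p, k ∈ range (2 * n + 1) ∧ p ∈ range (k + 1) ↔ k ∈ Finset.Ico p (2 * n + 1) ∧ p ∈ range (2 * n + 1) := fun k p => by
    simp only [Finset.mem_range, Finset.mem_Ico]
    omega
  rw [hP, Finset.sum_comm' hswap]
  refine Eq.trans (Finset.sum_congr rfl fun r hr => ?_) (Finset.sum_subset (Finset.range_mono (by omega : n + 1 ≤ 2 * n + 1)) fun a _ ha => ?_)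
  · rw [Finset.sum_Ico_eq_sum_range]
    refine Eq.trans (Finset.sum_congr rfl fun s _ => ?_) (Finset.sum_subset (Finset.range_mono (by have := Finset.mem_range.1 hr; omega : n + 1 ≤ 2 * n + 1 - r)) fun s _ hs => ?_)
    · rw [Nat.add_sub_cancel_left]
    · have hns : n < s := by rw [Finset.mem_range, not_lt] at hs; omega
      rw [Nat.add_sub_cancel_left, BettiUniverse.hodgeNumber_hodge_eq_zero_of_lt_snd hHD hX rfl hns, Nat.cast_zero, Polynomial.C_0, zero_mul, zero_mul]
  · have hna : n < a := by rw [Finset.mem_range, not_lt] at ha; omega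
    exact Finset.sum_eq_zero fun k _ => by rw [BettiUniverse.hodgeNumber_hodge_eq_zero_of_lt_fst hHD hX rfl hna, Nat.cast_zero, Polynomial.C_0, zero_mul, zero_mul]

/-! ### §2 The K3 Hodge diamond as `Π`, `χ_y`, `P` -/

section K3

variable {S : SchemeOver ℂ}

/-- **K3: `h^{1,2}(S) = 0`** given `H¹ = 0` (Serre–Poincaré dual to `h^{1,0} = 0`). [cite: Huybrechts2016K3, Ch. 1 §2.4 (2.7) and §3.3] [cite: Yui2013, §1.4 Example 1 (b) (held text p0221)] -/
theorem _root_.Literature.AlgebraicGeometry.Surfaces.IsK3Surface.hodgeNumber_hodge_three_one_two (hS : IsK3Surface S) (h : Huybrechts_K3_oddBetti_vanish)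
    (hHD : exists_isReal_hodgeModel) (hX : IsSmoothProjective 2 S) : (BettiUniverse.hodge hHD hX 3).hodgeNumber 1 2 = 0 := by
  have hd := BettiUniverse.hodgeNumber_hodge_duality hHD hX (p := 1) (q := 2) (p' := 1) (q' := 0) rfl rfl
  rw [show (1 : ℕ) + 2 = 3 from rfl, Nat.add_zero] at hd
  rw [← hS.hodgeNumber_hodge_one_one_zero h hHD hX]
  exact_mod_cast hd

/-- **K3: `h^{2,1}(S) = 0`** given `H¹ = 0` (Hodge symmetric to `h^{1,2} = 0`). [cite: Huybrechts2016K3, Ch. 1 §2.4 (2.7) and §3.3] [cite: Yui2013, §1.4 Example 1 (b) (held text p0221)] -/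
theorem _root_.Literature.AlgebraicGeometry.Surfaces.IsK3Surface.hodgeNumber_hodge_three_two_one (hS : IsK3Surface S) (h : Huybrechts_K3_oddBetti_vanish)
    (hHD : exists_isReal_hodgeModel) (hX : IsSmoothProjective 2 S) : (BettiUniverse.hodge hHD hX 3).hodgeNumber 2 1 = 0 := by
  rw [BettiUniverse.hodgeNumber_hodge_symm hHD hX 3 2 1]
  exact hS.hodgeNumber_hodge_three_one_two h hHD hX

/-- **Surfaces: `h^{2,2}(S) = 1`** for every smooth projective surface (Serre–Poincaré dual to `h^{0,0} = 1`). [cite: VoisinHodgeI2002, §6.3.2 and §6.1.3 Cor. 6.13]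
[cite: Arapura2012, §11.1 (PDF p. 174)] -/
theorem BettiUniverse.hodgeNumber_hodge_four_two_two_surface (hHD : exists_isReal_hodgeModel) (hX : IsSmoothProjective 2 S) :
    (BettiUniverse.hodge hHD hX 4).hodgeNumber 2 2 = 1 := by
  have hd := BettiUniverse.hodgeNumber_hodge_duality hHD hX (p := 2) (q := 2) (p' := 0) (q' := 0) rfl rfl
  have h00 : (BettiUniverse.hodge hHD hX (0 + 0)).hodgeNumber ((0 : ℕ) : ℤ) ((0 : ℕ) : ℤ) = 1 := by
    rw [Nat.add_zero]
    simp only [Nat.cast_zero]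
    exact BettiUniverse.hodgeNumber_hodge_zero_zero hHD hX
  rw [h00, show (2 : ℕ) + 2 = 4 from rfl] at hd
  exact_mod_cast hd

/-- **The K3 Hodge diamond as `Π(S) = 1 + y² + 20·yz + z² + y²z²`** (`h^{0,0} = h^{2,0} = h^{0,2} = h^{2,2} = 1`, `h^{1,1} = 20`, the rest `0`), given the two `Surfaces/` facts.
[cite: Huybrechts2016K3, Ch. 1 §2.4 (2.7) and §3.3] [cite: Yui2013, §1.4 Example 1 (b) (held text p0221)] [cite: Hirzebruch1966, §15.11 (held text p0138)] -/
theorem _root_.Literature.AlgebraicGeometry.Surfaces.IsK3Surface.hodgePoly (hS : IsK3Surface S) (h : Huybrechts_K3_oddBetti_vanish) (h22 : K3_finrank_complexBetti_two)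
    (hHD : exists_isReal_hodgeModel) (hX : IsSmoothProjective 2 S) :
    (∑ i ∈ range (2 + 1), ∑ j ∈ range (2 + 1),
        C (C (((BettiUniverse.hodge hHD hX (i + j)).hodgeNumber i j : ℕ) : ℤ) * Polynomial.X ^ i) * Polynomial.X ^ j : Polynomial (Polynomial ℤ)) =
      1 + C (Polynomial.X ^ 2) + C (C 20 * Polynomial.X) * Polynomial.X + Polynomial.X ^ 2 + C (Polynomial.X ^ 2) * Polynomial.X ^ 2 := by
  -- the nine Hodge numbers, in the syntactic shape produced by expanding the double sum
  have h00 : (BettiUniverse.hodge hHD hX (0 + 0)).hodgeNumber ((0 : ℕ) : ℤ) ((0 : ℕ) : ℤ) = 1 := by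
    have h := BettiUniverse.hodgeNumber_hodge_zero_zero hHD hX
    rw [Nat.add_zero]
    simp only [Nat.cast_zero]
    exact h
  have h01 : (BettiUniverse.hodge hHD hX (0 + 1)).hodgeNumber ((0 : ℕ) : ℤ) ((1 : ℕ) : ℤ) = 0 := by
    rw [Nat.zero_add]
    simp only [Nat.cast_zero, Nat.cast_one]
    rw [BettiUniverse.hodgeNumber_hodge_symm hHD hX 1 0 1]
    exact hS.hodgeNumber_hodge_one_one_zero h hHD hX
  have h02 : (BettiUniverse.hodge hHD hX (0 + 2)).hodgeNumber ((0 : ℕ) : ℤ) ((2 : ℕ) : ℤ) = 1 := by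
    rw [Nat.zero_add]
    simp only [Nat.cast_zero, Nat.cast_ofNat]
    exact hS.hodgeNumber_hodge_two_zero_two hHD hX
  have h10 : (BettiUniverse.hodge hHD hX (1 + 0)).hodgeNumber ((1 : ℕ) : ℤ) ((0 : ℕ) : ℤ) = 0 := by
    rw [Nat.add_zero]
    simp only [Nat.cast_zero, Nat.cast_one]
    exact hS.hodgeNumber_hodge_one_one_zero h hHD hX
  have h11 : (BettiUniverse.hodge hHD hX (1 + 1)).hodgeNumber ((1 : ℕ) : ℤ) ((1 : ℕ) : ℤ) = 20 := by
    rw [show (1 : ℕ) + 1 = 2 from rfl]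
    simp only [Nat.cast_one]
    exact hS.hodgeNumber_hodge_two_one_one h22 hHD hX
  have h12 : (BettiUniverse.hodge hHD hX (1 + 2)).hodgeNumber ((1 : ℕ) : ℤ) ((2 : ℕ) : ℤ) = 0 := by
    rw [show (1 : ℕ) + 2 = 3 from rfl]
    simp only [Nat.cast_one, Nat.cast_ofNat]
    exact hS.hodgeNumber_hodge_three_one_two h hHD hX
  have h20 : (BettiUniverse.hodge hHD hX (2 + 0)).hodgeNumber ((2 : ℕ) : ℤ) ((0 : ℕ) : ℤ) = 1 := by
    rw [Nat.add_zero]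
    simp only [Nat.cast_zero, Nat.cast_ofNat]
    exact hS.hodgeNumber_hodge_two_two_zero hHD hX
  have h21 : (BettiUniverse.hodge hHD hX (2 + 1)).hodgeNumber ((2 : ℕ) : ℤ) ((1 : ℕ) : ℤ) = 0 := by
    rw [show (2 : ℕ) + 1 = 3 from rfl]
    simp only [Nat.cast_one, Nat.cast_ofNat]
    exact hS.hodgeNumber_hodge_three_two_one h hHD hX
  have h22' : (BettiUniverse.hodge hHD hX (2 + 2)).hodgeNumber ((2 : ℕ) : ℤ) ((2 : ℕ) : ℤ) = 1 := by
    rw [show (2 : ℕ) + 2 = 4 from rfl]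
    simp only [Nat.cast_ofNat]
    exact BettiUniverse.hodgeNumber_hodge_four_two_two_surface hHD hX
  simp only [Finset.sum_range_succ, Finset.sum_range_zero, zero_add]
  rw [h00, h01, h02, h10, h11, h12, h20, h21, h22']
  simp only [Nat.cast_zero, Nat.cast_one, Nat.cast_ofNat, map_zero, map_one, zero_mul, add_zero, zero_add, pow_zero, pow_one, mul_one, one_mul]
  ring

/-- **K3: `χ_y(S) = 2 − 20y + 2y²`** (`χ^0 = 1 + 1`, `χ^1 = −20`, `χ^2 = 1 + 1`), given the two `Surfaces/` facts. [cite: Hirzebruch1966, §15.5 (12) (held text p0133)]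
[cite: Huybrechts2016K3, Ch. 1 §2.4 (2.7) and §3.3] [cite: Yui2013, §1.4 Example 1 (b) (held text p0221)] -/
theorem _root_.Literature.AlgebraicGeometry.Surfaces.IsK3Surface.chiYPoly (hS : IsK3Surface S) (h : Huybrechts_K3_oddBetti_vanish) (h22 : K3_finrank_complexBetti_two)
    (hHD : exists_isReal_hodgeModel) (hX : IsSmoothProjective 2 S) :
    ∑ i ∈ range (2 + 1), C (∑ q ∈ range (2 + 1), (-1 : ℤ) ^ q * ((BettiUniverse.hodge hHD hX (i + q)).hodgeNumber i q : ℤ)) * Polynomial.X ^ i =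
      C 2 - C 20 * Polynomial.X + C 2 * Polynomial.X ^ 2 := by
  have hPi := hS.hodgePoly h h22 hHD hX
  have heval := congrArg (Polynomial.eval (C (-1 : ℤ))) hPi
  rw [BettiUniverse.hodgePoly_eval_C_neg_one hHD hX] at heval
  rw [heval]
  simp only [Polynomial.eval_add, Polynomial.eval_one, Polynomial.eval_C, Polynomial.eval_mul, Polynomial.eval_pow, Polynomial.eval_X, map_neg, map_one, map_ofNat]
  ring

/-- **K3: `P(t; S) = 1 + 22t² + t⁴`** (`b₀ = b₄ = 1`, `b₁ = b₃ = 0`, `b₂ = 22`), given the two `Surfaces/` facts. [cite: Yui2013, §1.4 Example 1 (b) (held text p0221)]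
[cite: Huybrechts2016K3, Ch. 1 §3.3] [cite: HatcherAT2002, §3.2 Exercise 15 (held text p0296)] -/
theorem _root_.Literature.AlgebraicGeometry.Surfaces.IsK3Surface.poincarePoly (hS : IsK3Surface S) (h : Huybrechts_K3_oddBetti_vanish) (h22 : K3_finrank_complexBetti_two) :
    ∑ i ∈ range (2 * 2 + 1), C (Module.finrank ℚ (bettiCohomology S i) : ℤ) * Polynomial.X ^ i = 1 + C 22 * Polynomial.X ^ 2 + Polynomial.X ^ 4 := by
  simp only [Finset.sum_range_succ, Finset.sum_range_zero, zero_add]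
  rw [BettiUniverse.finrank_bettiCohomology_zero hS.isSmoothProjective, hS.finrank_bettiCohomology_one_eq_zero h, hS.finrank_bettiCohomology_two h22,
    hS.finrank_bettiCohomology_three_eq_zero h, BettiUniverse.finrank_bettiCohomology_top hS.isSmoothProjective]
  simp only [Nat.cast_zero, Nat.cast_one, Nat.cast_ofNat, map_zero, map_one, zero_mul, add_zero, pow_zero, mul_one, one_mul]

end K3

end Literature.AlgebraicGeometry.HodgeTheory

end
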